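import Summits.CriticalPhenomena.PercolationContinuityZ3.Theorems.PercNearOneGluingNoHeavyLowerTailSahiGridPatternTopCubeSharp
import Summits.CriticalPhenomena.PercolationContinuityZ3.Theorems.PercNearOneGluingNoHeavyLowerTailSahiGridPatternDiagCertBlockAndTheta
import Summits.CriticalPhenomena.PercolationContinuityZ3.Theorems.PercNearOneGluingNoHeavyLowerTailSahiGridPatternRoutingCert
import Literature.Combinatorics.SetFamily.IdealComplementPairing

/-!
# `NoHeavyLowerTail` (crux stmt-CriticalPhenomena-4575), Sahi programme P1: **CONJECTURE D IN EVERY DIMENSION** — the diagonal plan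
# `2^n·diag(1_S)` routes EVERY up-set `S` of EVERY top cube `{1,2}^n`:  `Θ_{S×V}(P×Q) ≤ 2^n Σ_{ξ∈S} Θ_V(P^ξ × Q^ξ)` for all up-sets `V, P, Q`, all `n, k`;
# hence BA₀(S): `S × V` is diagonally certified for every diagonally certified `V`, with NO certificate data

Support file (Sahi cell, seat `prim-sahi-p1`, generation 31; `--supports stmt-CriticalPhenomena-4575`).  Pure proofs, NO definitions, no `sorry`,
standard axioms.  Vocabulary of `…SahiGridPattern{,CellForm,SliceForm,ZDecomp,HarrisReduced,DiagCertBlockAndTheta,RoutingCert,TopCubeSharp}` and the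
Literature theorem `exists_bijOn_compl_superset_of_isUpperSet` (Erdős–Herzog–Schönheim 1970, `Literature/Combinatorics/SetFamily/IdealComplementPairing`).

THE MATHEMATICS (generation 30's memo §3.3 made formal; census §100 'CONJECTURE D').  `S ⊆ [3]^n` an up-set inside the top cube (no zero coordinate),
`V ⊆ [3]^k` an up-set, `A = S × V`, `P, Q ⊆ [3]^{n+k}` up-sets with fibres `X_q = P_q ⊆ [3]^n` and `Y_r = Q_r`.  Writing `Θ` at glued points
(`Θ_A(ξq, ηr) = [ξδ̸η][qδ̸r](1_S(ξ)1_V(q) + 1_S(η)1_V(r) − 1_S(ξ̄η)1_V(q̄r))`) and collecting by the pair `(q,r)` of cell points gives the FIBRE FORM of the slack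
(`slack_eq_fibreForm`):
  `2^nΣ_{ξ∈S}Θ_V(P^ξ×Q^ξ) − Θ_A(P×Q) = Σ_{q δ̸ r} [1_V(q)·H(S∩X_q;Y_r) + 1_V(r)·H(S∩Y_r;X_q) − 1_V(q̄r)·G(X_q,Y_r)]`,
`H(U;Y) = 2^n#(U∩Y) − N(U;Y)` (Harris slack), `G(X,Y) = 2^n#(S∩X∩Y) − Lat(X,Y;S)`.  In the Boolean cube of points `q δ̸ r` (chart `T ↦ r^T`, third point
`r^{Tᶜ}`) the DEMANDS `{q : q̄r ∈ V}` are the antipodal image of the SUPPLIES `{q ∈ V}`, so the Erdős–Herzog–Schönheim bijection `φ_r` (demand `q ↦`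
supply `φ_r q ≥ q`) re-indexes `Σ_{q∈V} H(S∩X_q;Y_r) = Σ_{q̄r∈V} H(S∩X_{φ_r q};Y_r)` (`ehs_reindex`), likewise `ψ_q` in the cube around `q`; the slack becomes
`Σ_{q δ̸ r, q̄r ∈ V} [H(S∩X_{φ_r q};Y_r) + H(S∩Y_{ψ_q r};X_q) − G(X_q,Y_r)]`, every bracket `≥ 0` by **CB⁺** (`topCube_cbPlus`, the counting form of
`topCube_witnessSum_sharp`) since fibres of up-sets grow along the order (`X_q ⊆ X_{φ_r q}`).  **THEOREM (`theta_blockAnd_le_diag_topCube`, all `n, k`).**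
COROLLARIES: (N) for `2^n·1_S ⊗ d` on `S × V` from (N) for `(V,d)` (`diagCert_blockAnd_N_topCube`, via `diagCert_blockAnd_N_of_routing` + `routeH_diag`), and
`[3]^m × (S × V)` a good first slot in every dimension given (T) (`sStarD_blockAnd_topCube_cylSet_nonneg`) — generation 30's 24 kernel-certificate instances
(`…RoutingCertTop2/Top3A–K`) and the census's 167 `j = 4` certificates are now special cases of one structural theorem.  Nothing here asserts `PatternPos d`
for `d ≥ 4`. [this work]
-/

namespace Summit.CriticalPhenomena.PercolationContinuityZ3.Theorems.SahiGridPattern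

open Finset SahiGrid3
open scoped BigOperators

variable {n k : ℕ}

/-! ### Small algebra -/

/-- Pulling three constants into a double sum. [this work] -/
theorem lin3_sum2 {ι κ : Type*} [Fintype ι] [Fintype κ] (a b c : ℤ) (f g h : ι → κ → ℤ) :
    a * (∑ x, ∑ y, f x y) + b * (∑ x, ∑ y, g x y) - c * (∑ x, ∑ y, h x y) = ∑ x, ∑ y, (a * f x y + b * g x y - c * h x y) := by
  rw [Finset.mul_sum, Finset.mul_sum, Finset.mul_sum, ← Finset.sum_add_distrib, ← Finset.sum_sub_distrib]
  refine Finset.sum_congr rfl fun x _ => ?_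
  rw [Finset.mul_sum, Finset.mul_sum, Finset.mul_sum, ← Finset.sum_add_distrib, ← Finset.sum_sub_distrib]

/-! ### CB⁺ in counting form -/

/-- **CB⁺ (counting form), every `n`**: for an up-set `S ⊆ [3]^n` with no zero coordinate and up-sets `X ⊆ X'`, `Y ⊆ Y'`,
`2^n#(S∩X∩Y) − Lat(X,Y;S) ≤ H(S∩X';Y) + H(S∩Y';X)`, all four quantities written as indicator sums. [this work] -/
theorem topCube_cbPlus (S : Finset (Pd n)) (hS : IsUpperSet (S : Set (Pd n))) (htop : ∀ u ∈ S, ∀ a, u a ≠ 0)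
    {X X' Y Y' : Finset (Pd n)} (hX : IsUpperSet (X : Set (Pd n))) (hX' : IsUpperSet (X' : Set (Pd n)))
    (hY : IsUpperSet (Y : Set (Pd n))) (hY' : IsUpperSet (Y' : Set (Pd n))) (hXX' : X ⊆ X') (hYY' : Y ⊆ Y') :
    (2:ℤ) ^ n * (∑ ξ, ind S ξ * ind X ξ * ind Y ξ)
        - (∑ ξ, ∑ η, ind X ξ * ind Y η * ind S (thirdPt ξ η) * (if TotDist ξ η = true then (1:ℤ) else 0))
      ≤ ((2:ℤ) ^ n * (∑ ξ, ind S ξ * ind X' ξ * ind Y ξ)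
          - ∑ ξ, ∑ η, ind S ξ * ind X' ξ * ind Y η * (if TotDist ξ η = true then (1:ℤ) else 0))
        + ((2:ℤ) ^ n * (∑ ξ, ind S ξ * ind X ξ * ind Y' ξ)
          - ∑ ξ, ∑ η, ind X ξ * ind S η * ind Y' η * (if TotDist ξ η = true then (1:ℤ) else 0)) := by
  have h := topCube_witnessSum_sharp S hS htop hX hX' hY hY' hXX' hYY'
  -- the witness sum, point by point, through the three chart identities
  have hw : ∀ u : Pd n, (∑ T : Finset (Fin n), (ind X (fromSet u T) - ind X' u) * (ind Y (fromSet u Tᶜ) - ind Y' u)) =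
      (∑ q, ∑ r, ind X q * ind Y r * (if thirdPt q r = u then (1:ℤ) else 0) * (if TotDist q r = true then (1:ℤ) else 0))
        - ind Y' u * (∑ p, ind X p * (if TotDist p u = true then (1:ℤ) else 0))
        - ind X' u * (∑ p, ind Y p * (if TotDist p u = true then (1:ℤ) else 0))
        + (2:ℤ) ^ n * (ind X' u * ind Y' u) := by
    intro u
    rw [sum_latin_through_eq_sum_chart X Y u, sum_ind_totDist_eq_sum_chart X u, sum_ind_totDist_eq_sum_chart Y u, ← sum_chart_compl Y u,
      ← card_finset_fin_pow, ← Finset.card_univ, ← nsmul_eq_mul, ← Finset.sum_const, Finset.mul_sum, Finset.mul_sum,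
      ← Finset.sum_sub_distrib, ← Finset.sum_sub_distrib, ← Finset.sum_add_distrib]
    exact Finset.sum_congr rfl fun T _ => by ring
  have hrhs : (∑ u ∈ S, ∑ T : Finset (Fin n), (ind X (fromSet u T) - ind X' u) * (ind Y (fromSet u Tᶜ) - ind Y' u)) =
      (∑ ξ, ∑ η, ind X ξ * ind Y η * ind S (thirdPt ξ η) * (if TotDist ξ η = true then (1:ℤ) else 0))
        - (∑ ξ, ∑ η, ind X ξ * ind S η * ind Y' η * (if TotDist ξ η = true then (1:ℤ) else 0))
        - (∑ ξ, ∑ η, ind S ξ * ind X' ξ * ind Y η * (if TotDist ξ η = true then (1:ℤ) else 0))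
        + (2:ℤ) ^ n * (∑ ξ, ind S ξ * ind X' ξ * ind Y' ξ) := by
    rw [sum_mem_eq_sum_ind_mul]
    simp_rw [hw]
    -- split into four sums
    have e0 : (∑ u, ind S u * ((∑ q, ∑ r, ind X q * ind Y r * (if thirdPt q r = u then (1:ℤ) else 0) * (if TotDist q r = true then (1:ℤ) else 0))
        - ind Y' u * (∑ p, ind X p * (if TotDist p u = true then (1:ℤ) else 0))
        - ind X' u * (∑ p, ind Y p * (if TotDist p u = true then (1:ℤ) else 0))
        + (2:ℤ) ^ n * (ind X' u * ind Y' u)))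
        = (∑ u, ind S u * (∑ q, ∑ r, ind X q * ind Y r * (if thirdPt q r = u then (1:ℤ) else 0) * (if TotDist q r = true then (1:ℤ) else 0)))
          - (∑ u, ind S u * (ind Y' u * (∑ p, ind X p * (if TotDist p u = true then (1:ℤ) else 0))))
          - (∑ u, ind S u * (ind X' u * (∑ p, ind Y p * (if TotDist p u = true then (1:ℤ) else 0))))
          + (∑ u, ind S u * ((2:ℤ) ^ n * (ind X' u * ind Y' u))) := by
      rw [← Finset.sum_sub_distrib, ← Finset.sum_sub_distrib, ← Finset.sum_add_distrib]
      exact Finset.sum_congr rfl fun u _ => by ring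
    have f1 : (∑ u, ind S u * (∑ q, ∑ r, ind X q * ind Y r * (if thirdPt q r = u then (1:ℤ) else 0) * (if TotDist q r = true then (1:ℤ) else 0)))
        = ∑ ξ, ∑ η, ind X ξ * ind Y η * ind S (thirdPt ξ η) * (if TotDist ξ η = true then (1:ℤ) else 0) := by
      have g1 : (∑ u, ind S u * (∑ q, ∑ r, ind X q * ind Y r * (if thirdPt q r = u then (1:ℤ) else 0) * (if TotDist q r = true then (1:ℤ) else 0)))
          = ∑ u, ∑ q, ∑ r, (if thirdPt q r = u then ind X q * ind Y r * ind S u * (if TotDist q r = true then (1:ℤ) else 0) else 0) := by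
        refine Finset.sum_congr rfl fun u _ => ?_
        rw [Finset.mul_sum]
        refine Finset.sum_congr rfl fun q _ => ?_
        rw [Finset.mul_sum]
        refine Finset.sum_congr rfl fun r _ => ?_
        split_ifs <;> ring
      have g2 : (∑ u, ∑ q, ∑ r, (if thirdPt q r = u then ind X q * ind Y r * ind S u * (if TotDist q r = true then (1:ℤ) else 0) else 0))
          = ∑ q, ∑ r, ∑ u, (if thirdPt q r = u then ind X q * ind Y r * ind S u * (if TotDist q r = true then (1:ℤ) else 0) else 0) := by
        rw [sum_comm3, sum_comm3]
      rw [g1, g2]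
      refine Finset.sum_congr rfl fun q _ => Finset.sum_congr rfl fun r _ => ?_
      rw [Finset.sum_ite_eq, if_pos (Finset.mem_univ _)]
    have f2 : (∑ u, ind S u * (ind Y' u * (∑ p, ind X p * (if TotDist p u = true then (1:ℤ) else 0))))
        = ∑ ξ, ∑ η, ind X ξ * ind S η * ind Y' η * (if TotDist ξ η = true then (1:ℤ) else 0) := by
      have g : (∑ u, ind S u * (ind Y' u * (∑ p, ind X p * (if TotDist p u = true then (1:ℤ) else 0))))
          = ∑ u, ∑ p, ind X p * ind S u * ind Y' u * (if TotDist p u = true then (1:ℤ) else 0) := by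
        refine Finset.sum_congr rfl fun u _ => ?_
        rw [Finset.mul_sum, Finset.mul_sum]
        exact Finset.sum_congr rfl fun p _ => by ring
      rw [g, Finset.sum_comm]
    have f3 : (∑ u, ind S u * (ind X' u * (∑ p, ind Y p * (if TotDist p u = true then (1:ℤ) else 0))))
        = ∑ ξ, ∑ η, ind S ξ * ind X' ξ * ind Y η * (if TotDist ξ η = true then (1:ℤ) else 0) := by
      refine Finset.sum_congr rfl fun u _ => ?_
      rw [Finset.mul_sum, Finset.mul_sum]
      exact Finset.sum_congr rfl fun p _ => by rw [totDist_symm p u]; ring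
    have f4 : (∑ u, ind S u * ((2:ℤ) ^ n * (ind X' u * ind Y' u))) = (2:ℤ) ^ n * (∑ ξ, ind S ξ * ind X' ξ * ind Y' ξ) := by
      rw [Finset.mul_sum]
      exact Finset.sum_congr rfl fun u _ => by ring
    rw [e0, f1, f2, f3, f4]
  have hlhs : (∑ u ∈ S, (ind X' u - ind X u) * (ind Y' u - ind Y u)) =
      (∑ ξ, ind S ξ * ind X' ξ * ind Y' ξ) - (∑ ξ, ind S ξ * ind X' ξ * ind Y ξ) - (∑ ξ, ind S ξ * ind X ξ * ind Y' ξ)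
        + ∑ ξ, ind S ξ * ind X ξ * ind Y ξ := by
    rw [sum_mem_eq_sum_ind_mul, ← Finset.sum_sub_distrib, ← Finset.sum_sub_distrib, ← Finset.sum_add_distrib]
    exact Finset.sum_congr rfl fun ξ _ => by ring
  rw [hrhs, hlhs] at h
  linarith

/-! ### Θ of the block product at glued points, and the fibre form of the slack -/

section FibreForm

variable {S : Finset (Pd n)} {V : Finset (Pd k)} {A : Finset (Pd (n + k))}

/-- Indicator of the block product (local copy). -/
private theorem ind_glue_blockAnd_loc (hA : ∀ ξ z, glue ξ z ∈ A ↔ (ξ ∈ S ∧ z ∈ V)) (ξ : Pd n) (z : Pd k) :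
    ind A (glue ξ z) = ind S ξ * ind V z := by
  unfold ind
  simp only [hA]
  by_cases h1 : ξ ∈ S <;> by_cases h2 : z ∈ V <;> simp [h1, h2]

/-- `Θ_{S×V}` at glued points, as a product of the two `[δ̸]` factors and the three-term bracket. [this work] -/
theorem thetaVal_glue_expand (hA : ∀ ξ z, glue ξ z ∈ A ↔ (ξ ∈ S ∧ z ∈ V)) (ξ η : Pd n) (q r : Pd k) :
    thetaVal A (glue ξ q) (glue η r) =
      (if TotDist ξ η = true then (1:ℤ) else 0) * (if TotDist q r = true then (1:ℤ) else 0) *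
        (ind S ξ * ind V q + ind S η * ind V r - ind S (thirdPt ξ η) * ind V (thirdPt q r)) := by
  unfold thetaVal
  rw [thirdPt_glue, ind_glue_blockAnd_loc hA, ind_glue_blockAnd_loc hA, ind_glue_blockAnd_loc hA]
  by_cases h1 : TotDist ξ η = true
  · by_cases h2 : TotDist q r = true
    · rw [if_pos ((totDist_glue ξ η q r).2 ⟨h1, h2⟩), if_pos h1, if_pos h2]; ring
    · have hn : ¬ TotDist (glue ξ q) (glue η r) = true := fun h => h2 ((totDist_glue ξ η q r).1 h).2
      rw [if_neg hn, if_pos h1, if_neg h2]; ring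
  · have hn : ¬ TotDist (glue ξ q) (glue η r) = true := fun h => h1 ((totDist_glue ξ η q r).1 h).1
    rw [if_neg hn, if_neg h1]; ring

/-- **The left-hand side by cell pairs**: `Θ_A(P×Q) = Σ_{q,r} [qδ̸r]·(1_V(q)·N(S∩X_q;Y_r) + 1_V(r)·N(S∩Y_r;X_q) − 1_V(q̄r)·Lat(X_q,Y_r;S))`. [this work] -/
theorem theta_pairs_eq_cellSum (hA : ∀ ξ z, glue ξ z ∈ A ↔ (ξ ∈ S ∧ z ∈ V)) (P Q : Finset (Pd (n + k))) :
    (∑ x ∈ P, ∑ y ∈ Q, thetaVal A x y) = ∑ q : Pd k, ∑ r : Pd k, (if TotDist q r = true then (1:ℤ) else 0) *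
      (ind V q * (∑ ξ, ∑ η, ind S ξ * ind P (glue ξ q) * ind Q (glue η r) * (if TotDist ξ η = true then (1:ℤ) else 0))
        + ind V r * (∑ ξ, ∑ η, ind P (glue ξ q) * ind S η * ind Q (glue η r) * (if TotDist ξ η = true then (1:ℤ) else 0))
        - ind V (thirdPt q r) *
          (∑ ξ, ∑ η, ind P (glue ξ q) * ind Q (glue η r) * ind S (thirdPt ξ η) * (if TotDist ξ η = true then (1:ℤ) else 0))) := by
  rw [theta_pairs_eq_sum4]
  -- reorder `Σ_ξ Σ_q Σ_η Σ_r` into `Σ_q Σ_r Σ_ξ Σ_η`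
  have e0 : (∑ ξ : Pd n, ∑ q : Pd k, ∑ η : Pd n, ∑ r : Pd k, ind P (glue ξ q) * ind Q (glue η r) * thetaVal A (glue ξ q) (glue η r))
      = ∑ q : Pd k, ∑ ξ : Pd n, ∑ η : Pd n, ∑ r : Pd k, ind P (glue ξ q) * ind Q (glue η r) * thetaVal A (glue ξ q) (glue η r) :=
    Finset.sum_comm
  rw [e0]
  refine Finset.sum_congr rfl fun q _ => ?_
  have e1 : (∑ ξ : Pd n, ∑ η : Pd n, ∑ r : Pd k, ind P (glue ξ q) * ind Q (glue η r) * thetaVal A (glue ξ q) (glue η r))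
      = ∑ r : Pd k, ∑ ξ : Pd n, ∑ η : Pd n, ind P (glue ξ q) * ind Q (glue η r) * thetaVal A (glue ξ q) (glue η r) := sum_comm3 _
  rw [e1]
  refine Finset.sum_congr rfl fun r _ => ?_
  rw [lin3_sum2, Finset.mul_sum]
  refine Finset.sum_congr rfl fun ξ _ => ?_
  rw [Finset.mul_sum]
  refine Finset.sum_congr rfl fun η _ => ?_
  rw [thetaVal_glue_expand hA]; ring

/-- **The right-hand side by cell pairs**: `2^nΣ_{ξ∈S}Θ_V(P^ξ×Q^ξ) = Σ_{q,r}[qδ̸r]·(1_V(q)+1_V(r)−1_V(q̄r))·2^n#(S∩X_q∩Y_r)`. [this work] -/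
theorem diag_sections_eq_cellSum (S : Finset (Pd n)) (V : Finset (Pd k)) (P Q : Finset (Pd (n + k))) :
    (∑ ξ : Pd n, ∑ η : Pd n, (if ξ = η then (2:ℤ) ^ n * ind S ξ else 0) * ∑ q ∈ sect P ξ, ∑ r ∈ sect Q η, thetaVal V q r) =
      ∑ q : Pd k, ∑ r : Pd k, (if TotDist q r = true then (1:ℤ) else 0) * (ind V q + ind V r - ind V (thirdPt q r)) *
        ((2:ℤ) ^ n * ∑ ξ, ind S ξ * ind P (glue ξ q) * ind Q (glue ξ r)) := by
  have h1 : ∀ ξ : Pd n, (∑ η : Pd n, (if ξ = η then (2:ℤ) ^ n * ind S ξ else 0) * ∑ q ∈ sect P ξ, ∑ r ∈ sect Q η, thetaVal V q r)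
      = (2:ℤ) ^ n * ind S ξ * ∑ q ∈ sect P ξ, ∑ r ∈ sect Q ξ, thetaVal V q r := by
    intro ξ
    have e : ∀ η : Pd n, (if ξ = η then (2:ℤ) ^ n * ind S ξ else 0) * (∑ q ∈ sect P ξ, ∑ r ∈ sect Q η, thetaVal V q r)
        = if ξ = η then (2:ℤ) ^ n * ind S ξ * ∑ q ∈ sect P ξ, ∑ r ∈ sect Q η, thetaVal V q r else 0 := by
      intro η; split_ifs <;> ring
    simp only [e, Finset.sum_ite_eq, Finset.mem_univ, if_true]
  simp_rw [h1]
  have h2 : ∀ ξ : Pd n, (∑ q ∈ sect P ξ, ∑ r ∈ sect Q ξ, thetaVal V q r)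
      = ∑ q : Pd k, ∑ r : Pd k, ind P (glue ξ q) * ind Q (glue ξ r) * thetaVal V q r := by
    intro ξ
    rw [sum_mem_eq_sum_ind_mul (sect P ξ)]
    refine Finset.sum_congr rfl fun q _ => ?_
    rw [sum_mem_eq_sum_ind_mul (sect Q ξ), Finset.mul_sum]
    refine Finset.sum_congr rfl fun r _ => ?_
    rw [ind_sect, ind_sect]; ring
  simp_rw [h2]
  -- reorder `Σ_ξ Σ_q Σ_r` into `Σ_q Σ_r Σ_ξ`
  have h3 : (∑ ξ : Pd n, (2:ℤ) ^ n * ind S ξ * ∑ q : Pd k, ∑ r : Pd k, ind P (glue ξ q) * ind Q (glue ξ r) * thetaVal V q r)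
      = ∑ ξ : Pd n, ∑ q : Pd k, ∑ r : Pd k, (2:ℤ) ^ n * ind S ξ * (ind P (glue ξ q) * ind Q (glue ξ r) * thetaVal V q r) := by
    refine Finset.sum_congr rfl fun ξ _ => ?_
    rw [Finset.mul_sum]
    refine Finset.sum_congr rfl fun q _ => ?_
    rw [Finset.mul_sum]
  rw [h3, sum_comm3, sum_comm3]
  refine Finset.sum_congr rfl fun q _ => Finset.sum_congr rfl fun r _ => ?_
  rw [Finset.mul_sum, Finset.mul_sum]
  refine Finset.sum_congr rfl fun ξ _ => ?_
  unfold thetaVal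
  split_ifs <;> ring

/-- **THE FIBRE FORM OF THE SLACK** (generation 30's identity (ii)):
`2^nΣ_{ξ∈S}Θ_V(P^ξ×Q^ξ) − Θ_{S×V}(P×Q) = Σ_{q,r}[qδ̸r]·(1_V(q)·H(S∩X_q;Y_r) + 1_V(r)·H(S∩Y_r;X_q) − 1_V(q̄r)·G(X_q,Y_r))`. [this work] -/
theorem slack_eq_fibreForm (hA : ∀ ξ z, glue ξ z ∈ A ↔ (ξ ∈ S ∧ z ∈ V)) (P Q : Finset (Pd (n + k))) :
    (∑ ξ : Pd n, ∑ η : Pd n, (if ξ = η then (2:ℤ) ^ n * ind S ξ else 0) * ∑ q ∈ sect P ξ, ∑ r ∈ sect Q η, thetaVal V q r)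
      - (∑ x ∈ P, ∑ y ∈ Q, thetaVal A x y) =
    ∑ q : Pd k, ∑ r : Pd k, (if TotDist q r = true then (1:ℤ) else 0) *
      (ind V q * ((2:ℤ) ^ n * (∑ ξ, ind S ξ * ind P (glue ξ q) * ind Q (glue ξ r))
          - ∑ ξ, ∑ η, ind S ξ * ind P (glue ξ q) * ind Q (glue η r) * (if TotDist ξ η = true then (1:ℤ) else 0))
        + ind V r * ((2:ℤ) ^ n * (∑ ξ, ind S ξ * ind P (glue ξ q) * ind Q (glue ξ r))
          - ∑ ξ, ∑ η, ind P (glue ξ q) * ind S η * ind Q (glue η r) * (if TotDist ξ η = true then (1:ℤ) else 0))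
        - ind V (thirdPt q r) * ((2:ℤ) ^ n * (∑ ξ, ind S ξ * ind P (glue ξ q) * ind Q (glue ξ r))
          - ∑ ξ, ∑ η, ind P (glue ξ q) * ind Q (glue η r) * ind S (thirdPt ξ η) * (if TotDist ξ η = true then (1:ℤ) else 0))) := by
  rw [diag_sections_eq_cellSum, theta_pairs_eq_cellSum hA, ← Finset.sum_sub_distrib]
  refine Finset.sum_congr rfl fun q _ => ?_
  rw [← Finset.sum_sub_distrib]
  refine Finset.sum_congr rfl fun r _ => ?_
  ring

end FibreForm

/-! ### The Erdős–Herzog–Schönheim re-indexing in the cube around a cell point -/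

/-- The demand family is the complement image of the supply family: `{T : r^{Tᶜ} ∈ V} = {univ ∖ T : r^T ∈ V}`. [this work] -/
theorem fam_compl_eq_image (r : Pd k) (V : Finset (Pd k)) :
    (univ.filter fun T : Finset (Fin k) => fromSet r Tᶜ ∈ V) = (fam r V).image fun T => univ \ T := by
  ext B
  simp only [Finset.mem_filter, Finset.mem_univ, true_and, Finset.mem_image, mem_fam]
  constructor
  · intro h; exact ⟨Bᶜ, h, by rw [← Finset.compl_eq_univ_sdiff, compl_compl]⟩
  · rintro ⟨T, hT, rfl⟩; rw [← Finset.compl_eq_univ_sdiff, compl_compl]; exact hT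

/-- **EHS re-indexing** (every `k`): for an up-set `V ⊆ [3]^k`, a cell point `r`, and the Erdős–Herzog–Schönheim bijection `f` of the cube around `r`
(demands `{T : r^{Tᶜ} ∈ V}` onto supplies `{T : r^T ∈ V}`, `T ⊆ f T`):  `Σ_{qδ̸r} 1_V(q)·F(q) = Σ_{qδ̸r} 1_V(q̄r)·F(r^{f(toSet r q)})`. [this work] -/
theorem ehs_reindex (V : Finset (Pd k)) (r : Pd k) (f : Finset (Fin k) → Finset (Fin k))
    (hf : Set.BijOn f ((fam r V).image fun T => univ \ T) (fam r V)) (F : Pd k → ℤ) :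
    (∑ q : Pd k, (if TotDist q r = true then (1:ℤ) else 0) * (ind V q * F q)) =
      ∑ q : Pd k, (if TotDist q r = true then (1:ℤ) else 0) * (ind V (thirdPt q r) * F (fromSet r (f (toSet r q)))) := by
  have hL : (∑ q : Pd k, (if TotDist q r = true then (1:ℤ) else 0) * (ind V q * F q)) = ∑ T ∈ fam r V, F (fromSet r T) := by
    simp only [boole_mul]
    rw [← Finset.sum_filter, sum_totDist_eq_sum_sets r (fun q => ind V q * F q)]
    rw [show fam r V = univ.filter (fun T : Finset (Fin k) => fromSet r T ∈ V) from rfl, Finset.sum_filter]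
    refine Finset.sum_congr rfl fun T _ => ?_
    unfold ind; split_ifs <;> ring
  have hR : (∑ q : Pd k, (if TotDist q r = true then (1:ℤ) else 0) * (ind V (thirdPt q r) * F (fromSet r (f (toSet r q)))))
      = ∑ B ∈ (univ.filter fun T : Finset (Fin k) => fromSet r Tᶜ ∈ V), F (fromSet r (f B)) := by
    simp only [boole_mul]
    rw [← Finset.sum_filter, sum_totDist_eq_sum_sets r (fun q => ind V (thirdPt q r) * F (fromSet r (f (toSet r q)))), Finset.sum_filter]
    refine Finset.sum_congr rfl fun T _ => ?_
    rw [thirdPt_fromSet, toSet_fromSet]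
    unfold ind; split_ifs <;> ring
  rw [hL, hR, fam_compl_eq_image]
  have himg : ((fam r V).image fun T => univ \ T).image f = fam r V := by
    rw [← Finset.coe_inj, Finset.coe_image]; exact hf.image_eq
  rw [← himg, Finset.sum_image (fun B hB B' hB' h => hf.injOn hB hB' h), himg]

/-- The EHS map of a demand point is a supply point above it: `q ≤ r^{f(toSet r q)}` and `r^{f(toSet r q)} ∈ V` when `qδ̸r`, `q̄r ∈ V`. [this work] -/
theorem ehs_point (V : Finset (Pd k)) (r : Pd k) (f : Finset (Fin k) → Finset (Fin k))
    (hf : Set.BijOn f ((fam r V).image fun T => univ \ T) (fam r V)) (hsub : ∀ B ∈ (fam r V).image (fun T => univ \ T), B ⊆ f B)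
    {q : Pd k} (hq : TotDist q r = true) (hm : thirdPt q r ∈ V) :
    q ≤ fromSet r (f (toSet r q)) ∧ fromSet r (f (toSet r q)) ∈ V := by
  have hB : toSet r q ∈ (fam r V).image (fun T => univ \ T) := by
    rw [← fam_compl_eq_image, Finset.mem_filter]
    refine ⟨mem_univ _, ?_⟩
    rw [← thirdPt_fromSet, fromSet_toSet hq]; exact hm
  refine ⟨?_, mem_fam.1 (hf.mapsTo hB)⟩
  calc q = fromSet r (toSet r q) := (fromSet_toSet hq).symm
    _ ≤ fromSet r (f (toSet r q)) := fromSet_mono r (hsub _ hB)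

/-! ### CONJECTURE D -/

/-- **THEOREM (CONJECTURE D; the diagonal plan routes every top-cube up-set; all `n, k`).**  For an up-set `S ⊆ [3]^n` with no zero coordinate, an up-set
`V ⊆ [3]^k`, `A = S × V` and all up-sets `P, Q ⊆ [3]^{n+k}`:  `Θ_A(P×Q) ≤ Σ_ξ Σ_η [ξ=η]·2^n·1_S(ξ) · Θ_V(P^ξ × Q^η)`. [this work] -/
theorem theta_blockAnd_le_diag_topCube {S : Finset (Pd n)} (hS : IsUpperSet (S : Set (Pd n))) (htop : ∀ ξ ∈ S, ∀ a, ξ a ≠ 0)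
    {V : Finset (Pd k)} (hV : IsUpperSet (V : Set (Pd k))) {A : Finset (Pd (n + k))} (hA : ∀ ξ z, glue ξ z ∈ A ↔ (ξ ∈ S ∧ z ∈ V))
    {P Q : Finset (Pd (n + k))} (hP : IsUpperSet (P : Set (Pd (n + k)))) (hQ : IsUpperSet (Q : Set (Pd (n + k)))) :
    (∑ x ∈ P, ∑ y ∈ Q, thetaVal A x y) ≤
      ∑ ξ : Pd n, ∑ η : Pd n, (if ξ = η then (2:ℤ) ^ n * ind S ξ else 0) * ∑ q ∈ sect P ξ, ∑ r ∈ sect Q η, thetaVal V q r := by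
  -- the two Erdős–Herzog–Schönheim families of bijections
  have hE : ∀ r : Pd k, ∃ f : Finset (Fin k) → Finset (Fin k), Set.BijOn f ((fam r V).image fun T => univ \ T) (fam r V) ∧
      ∀ B ∈ (fam r V).image (fun T => univ \ T), B ⊆ f B :=
    fun r => Literature.Combinatorics.SetFamily.exists_bijOn_compl_superset_of_isUpperSet (fam r V) (isUpperSet_fam r hV)
  choose f hf hfs using hE
  -- abbreviations for the three fibre quantities
  set tdn : Pd n → Pd n → ℤ := fun ξ η => if TotDist ξ η = true then (1:ℤ) else 0 with htdn
  set td : Pd k → Pd k → ℤ := fun q r => if TotDist q r = true then (1:ℤ) else 0 with htd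
  set Hx : Pd k → Pd k → ℤ := fun q r => (2:ℤ) ^ n * (∑ ξ, ind S ξ * ind P (glue ξ q) * ind Q (glue ξ r))
      - ∑ ξ, ∑ η, ind S ξ * ind P (glue ξ q) * ind Q (glue η r) * tdn ξ η with hHx
  set Hy : Pd k → Pd k → ℤ := fun q r => (2:ℤ) ^ n * (∑ ξ, ind S ξ * ind P (glue ξ q) * ind Q (glue ξ r))
      - ∑ ξ, ∑ η, ind P (glue ξ q) * ind S η * ind Q (glue η r) * tdn ξ η with hHy
  set G : Pd k → Pd k → ℤ := fun q r => (2:ℤ) ^ n * (∑ ξ, ind S ξ * ind P (glue ξ q) * ind Q (glue ξ r))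
      - ∑ ξ, ∑ η, ind P (glue ξ q) * ind Q (glue η r) * ind S (thirdPt ξ η) * tdn ξ η with hG
  have hslack := slack_eq_fibreForm hA P Q
  rw [← sub_nonneg, hslack]
  -- the slack, re-indexed: Σ_q Σ_r td·(V q Hx + V r Hy − V m G) = Σ_q Σ_r td · V m · (Hx(φ q) + Hy(ψ r) − G)
  have key : (∑ q : Pd k, ∑ r : Pd k, td q r * (ind V q * Hx q r + ind V r * Hy q r - ind V (thirdPt q r) * G q r)) =
      ∑ q : Pd k, ∑ r : Pd k, td q r * (ind V (thirdPt q r) *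
        (Hx (fromSet r (f r (toSet r q))) r + Hy q (fromSet q (f q (toSet q r))) - G q r)) := by
    have s1 : (∑ q : Pd k, ∑ r : Pd k, td q r * (ind V q * Hx q r)) = ∑ q : Pd k, ∑ r : Pd k, td q r * (ind V (thirdPt q r) * Hx (fromSet r (f r (toSet r q))) r) := by
      rw [Finset.sum_comm]
      conv_rhs => rw [Finset.sum_comm]
      refine Finset.sum_congr rfl fun r _ => ?_
      exact ehs_reindex V r (f r) (hf r) (fun q => Hx q r)
    have s2 : (∑ q : Pd k, ∑ r : Pd k, td q r * (ind V r * Hy q r)) = ∑ q : Pd k, ∑ r : Pd k, td q r * (ind V (thirdPt q r) * Hy q (fromSet q (f q (toSet q r)))) := by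
      refine Finset.sum_congr rfl fun q _ => ?_
      have e := ehs_reindex V q (f q) (hf q) (fun r => Hy q r)
      have e' : ∀ r, td q r = td r q := fun r => by simp only [htd, totDist_symm q r]
      simp only [e', thirdPt_comm q]
      exact e
    have split : ∀ q r : Pd k, td q r * (ind V q * Hx q r + ind V r * Hy q r - ind V (thirdPt q r) * G q r)
        = td q r * (ind V q * Hx q r) + td q r * (ind V r * Hy q r) - td q r * (ind V (thirdPt q r) * G q r) := fun q r => by ring
    have split' : ∀ q r : Pd k, td q r * (ind V (thirdPt q r) * (Hx (fromSet r (f r (toSet r q))) r + Hy q (fromSet q (f q (toSet q r))) - G q r))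
        = td q r * (ind V (thirdPt q r) * Hx (fromSet r (f r (toSet r q))) r) + td q r * (ind V (thirdPt q r) * Hy q (fromSet q (f q (toSet q r))))
          - td q r * (ind V (thirdPt q r) * G q r) := fun q r => by ring
    simp only [split, split', Finset.sum_add_distrib, Finset.sum_sub_distrib]
    rw [s1, s2]
  rw [key]
  -- termwise nonnegativity by CB⁺
  refine Finset.sum_nonneg fun q _ => Finset.sum_nonneg fun r _ => ?_
  by_cases hqr : TotDist q r = true
  · by_cases hm : thirdPt q r ∈ V
    · obtain ⟨hle1, -⟩ := ehs_point V r (f r) (hf r) (hfs r) hqr hm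
      have hqr' : TotDist r q = true := by rw [totDist_symm]; exact hqr
      have hm' : thirdPt r q ∈ V := by rw [thirdPt_comm]; exact hm
      obtain ⟨hle2, -⟩ := ehs_point V q (f q) (hf q) (hfs q) hqr' hm'
      have hX : fibre P q ⊆ fibre P (fromSet r (f r (toSet r q))) := fun ξ hξ => by
        rw [show fibre P q = univ.filter (fun ξ => glue ξ q ∈ P) from rfl, Finset.mem_filter] at hξ
        rw [show fibre P (fromSet r (f r (toSet r q))) = univ.filter (fun ξ => glue ξ (fromSet r (f r (toSet r q))) ∈ P) from rfl, Finset.mem_filter]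
        exact ⟨mem_univ _, hP (glue_le_glue_iff.2 ⟨le_rfl, hle1⟩) hξ.2⟩
      have hY : fibre Q r ⊆ fibre Q (fromSet q (f q (toSet q r))) := fun η hη => by
        rw [show fibre Q r = univ.filter (fun η => glue η r ∈ Q) from rfl, Finset.mem_filter] at hη
        rw [show fibre Q (fromSet q (f q (toSet q r))) = univ.filter (fun η => glue η (fromSet q (f q (toSet q r))) ∈ Q) from rfl, Finset.mem_filter]
        exact ⟨mem_univ _, hQ (glue_le_glue_iff.2 ⟨le_rfl, hle2⟩) hη.2⟩
      have hcb := topCube_cbPlus S hS htop (isUpperSet_fibre hP q) (isUpperSet_fibre hP _) (isUpperSet_fibre hQ r) (isUpperSet_fibre hQ _) hX hY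
      simp only [ind_fibre] at hcb
      have htd1 : td q r = 1 := by simp only [htd, if_pos hqr]
      rw [htd1, one_mul]
      refine mul_nonneg (ind_nonneg' V _) ?_
      simp only [hHx, hHy, hG, htdn]
      linarith
    · have h0 : ind V (thirdPt q r) = 0 := by unfold ind; rw [if_neg hm]
      rw [h0]; simp
  · have h0 : td q r = 0 := by simp only [htd, if_neg hqr]
    rw [h0]; simp

/-- **(N) for `2^n·1_S ⊗ d` on `S × V`, every top-cube up-set `S`, every `k`** (no certificate): `Θ_A(P×Q) ≤ Σ_{x∈P∩Q} 2^n·1_S(freeOf x)·d(cellOf x)` for all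
up-sets `P, Q`, given `d ≥ 0` with (N) for `(V, d)`. [this work] -/
theorem diagCert_blockAnd_N_topCube {S : Finset (Pd n)} (hS : IsUpperSet (S : Set (Pd n))) (htop : ∀ ξ ∈ S, ∀ a, ξ a ≠ 0)
    {V : Finset (Pd k)} (hV : IsUpperSet (V : Set (Pd k))) {A : Finset (Pd (n + k))} (hA : ∀ ξ z, glue ξ z ∈ A ↔ (ξ ∈ S ∧ z ∈ V))
    (d : Pd k → ℤ) (hd : ∀ q, 0 ≤ d q)
    (hN : ∀ X X' : Finset (Pd k), IsUpperSet (X : Set (Pd k)) → IsUpperSet (X' : Set (Pd k)) → (∑ q ∈ X, ∑ r ∈ X', thetaVal V q r) ≤ ∑ q ∈ X ∩ X', d q)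
    {P Q : Finset (Pd (n + k))} (hP : IsUpperSet (P : Set (Pd (n + k)))) (hQ : IsUpperSet (Q : Set (Pd (n + k)))) :
    (∑ x ∈ P, ∑ y ∈ Q, thetaVal A x y) ≤ ∑ x ∈ P ∩ Q, (2:ℤ) ^ n * ind S (freeOf x) * d (cellOf x) :=
  diagCert_blockAnd_N_of_routing hA d hd hN (fun ξ η => if ξ = η then (2:ℤ) ^ n * ind S ξ else 0) (routeDiag_nonneg S)
    (fun X X' _ _ => routeH_diag S X X') (fun _ _ hP' hQ' => theta_blockAnd_le_diag_topCube hS htop hV hA hP' hQ') hP hQ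

/-- **THEOREM BA₀(S) FOR EVERY TOP-CUBE UP-SET `S` (every `n`, `k`, `m`; no certificate).**  With (T) for `d' = 2^n·1_S ⊗ d` on `A = S × V` (hypothesis `hT'`,
supplied by `…DiagCertBlockAndT.diagCert_blockAnd_T` for every up-set `S` and every `d` with (T) for `V`): `0 ≤ sStarD ([3]^m × A) B C` for all up-sets `B, C`.
[this work] -/
theorem sStarD_blockAnd_topCube_cylSet_nonneg {m : ℕ} {S : Finset (Pd n)} (hS : IsUpperSet (S : Set (Pd n))) (htop : ∀ ξ ∈ S, ∀ a, ξ a ≠ 0)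
    {V : Finset (Pd k)} (hV : IsUpperSet (V : Set (Pd k))) {A : Finset (Pd (n + k))} (hA : ∀ ξ z, glue ξ z ∈ A ↔ (ξ ∈ S ∧ z ∈ V))
    (d : Pd k → ℤ) (hd : ∀ q, 0 ≤ d q)
    (hN : ∀ X X' : Finset (Pd k), IsUpperSet (X : Set (Pd k)) → IsUpperSet (X' : Set (Pd k)) → (∑ q ∈ X, ∑ r ∈ X', thetaVal V q r) ≤ ∑ q ∈ X ∩ X', d q)
    (hT' : ∀ W : Finset (Pd (n + k)), IsUpperSet (W : Set (Pd (n + k))) → (∑ x ∈ W, (2:ℤ) ^ n * ind S (freeOf x) * d (cellOf x)) ≤ ∑ x ∈ W, lamU A x)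
    {B C : Finset (Pd (m + (n + k)))} (hB : IsUpperSet (B : Set (Pd (m + (n + k))))) (hC : IsUpperSet (C : Set (Pd (m + (n + k))))) :
    0 ≤ sStarD (cylSet A : Finset (Pd (m + (n + k)))) B C :=
  sStarD_blockAnd_cylSet_nonneg_of_routing hA d hd hN (fun ξ η => if ξ = η then (2:ℤ) ^ n * ind S ξ else 0) (routeDiag_nonneg S)
    (fun X X' _ _ => routeH_diag S X X') (fun _ _ hP' hQ' => theta_blockAnd_le_diag_topCube hS htop hV hA hP' hQ') hT' hB hC

end Summit.CriticalPhenomena.PercolationContinuityZ3.Theorems.SahiGridPattern
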